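import Literature.Dynamics.Homogeneous.OrthogonalGroupOrbitClosuresTransvections
import Literature.Dynamics.Homogeneous.OrthogonalGroupOrbitClosuresCommutant
import HarnessLib

/-!
# Verbitsky's orbit-closure trichotomy for `Λ_{K3}`: reduction to the structure of the Ratner group

Topic `Literature/Dynamics/Homogeneous`; theorems only (no new notion, no named fact — D-0026), on
top of `…Transvections` (transitivity by Eichler transvections) and `…Commutant` (→ `…FixedSpaces`,
`…K3Plane`, `…Unipotents`, `…Subalgebras`, `…Proofs`). This file ASSEMBLES the Ratner-theoretic
proof of `Literature.Dynamics.Homogeneous.Verbitsky2017_orbitClosure_trichotomy_K3`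
[Verbitsky2017ErgodicErratum, §2.3] down to the bare outputs of the four classical theorems it
rests on, all of which are absent from Mathlib and `Literature/`:

* RATNER'S ORBIT-CLOSURE THEOREM [Morris2005Ratner, Thm. 1.1.14, Rem. 1.1.15, Rem. 1.1.19]
  (Ratner 1991) for `G = O(Λ_{K3} ⊗ ℝ)`, the lattice `Γ = SO(Λ_{K3})` (BOREL–HARISH-CHANDRA
  [Morris2005Ratner, §4.8]) and the subgroup `H° = SO⁺(P_x^⊥)` generated by the Eichler flows
  orthogonal to the frame of a period point `x` (erratum §2.2): a closed connected `P` with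
  `H° ≤ P ≤ G`, `cl(Γ H°) = Γ P`, `P ∩ Γ` a lattice in `P`;
* the LIE CORRESPONDENCE for closed subgroups of `GL₂₂(ℝ)` together with the classification of the
  Lie subalgebras between `𝔰𝔬(P_x^⊥)` and `𝔰𝔬(3,19)` PROVED in `…Subalgebras` (erratum §2.1),
  which leaves three shapes for `P`; and
* the BOREL DENSITY THEOREM [Morris2005Ratner, §4.7] for the lattice `P ∩ Γ` of `P` (standard and
  conjugation representations).

Main result: `Verbitsky2017_orbitClosure_trichotomy_K3_of_ratnerGroup` — IF for every period point
`x` there is a set `P` of real isometries, multiplicatively closed with `1`, contained in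
`cl(Γ · Stab(x))`, which either (A) contains all Eichler transvections, or (B) contains those
orthogonal to a nonzero `v₀ ∈ P_x`, fixes `v₀`, and has the Borel-density property "vectors fixed
by the integral elements of `P` are fixed by these transvections", or (C) preserves `P_x` and has
the Borel-density property "matrices commuting with the integral elements of `P` commute with the
transvections orthogonal to `P_x`", THEN `Verbitsky2017_orbitClosure_trichotomy_K3` holds. The
three cases are `mem_closure_orbit_of_ratnerGroup_top` (transitivity of transvections on frames),
`mem_closure_orbit_of_ratnerGroup_line` (the line `ℝ v₀ = Fix(P ∩ Γ)` is rational, then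
transitivity of the transvections fixing `v₀`) and `k3_isRationalPlane_of_ratnerGroup_plane` (the
plane is rational: the orthogonal projection onto `P_x` commutes with `P ∩ Γ`, hence is a real
combination of INTEGRAL commuting matrices, each a rational scalar on `P_x^⊥` by the multiplicity
lemma of `…Commutant`, so `P_x^⊥` and then `P_x` are cut out by integral matrices —
`…FixedSpaces`), fed into `Verbitsky2017_orbitClosure_trichotomy_K3_of_frameOrbitClosure`
(`…Proofs`).
Finally (`section ExpBridge`) the Eichler flows `t ↦ exp(t T_{u,w})` (`IsNilpotent.exp`, the finite
exponential sum of a cube-zero matrix) are computed: `exp(t [T_{u,w}]) = [E_{u, t w}]`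
(`exp_smul_toMatrix_eichlerT`), so the unipotent one-parameter subgroups generating `H°` in a
matrix rendering of Ratner's theorem take values in `eichlerGens`, and conversely.

## References

* [Verbitsky2017ErgodicErratum] M. Verbitsky, Ergodic complex structures on hyperkähler manifolds:
  an erratum, arXiv:1708.05802 (2017), §2.3 (proof of the Theorem), §2.2 (Ratner's theorem for
  `H = SO⁺(a−2,b) ⊂ G = SO⁺(a,b)`), §2.1 (Lie subalgebras containing `𝔰𝔬(V₀)`).
* [Morris2005Ratner] D. W. Morris, Ratner's Theorems on Unipotent Flows, Univ. of Chicago Press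
  2005 (arXiv:math/0310402), Thm. 1.1.14, Rem. 1.1.15, Rem. 1.1.19 (orbit closures), §4.7 (Borel
  density theorem), §4.8 (arithmetic lattices; Borel–Harish-Chandra).
* [Huybrechts2016K3] D. Huybrechts, Lectures on K3 Surfaces, CUP 2016, Ch. 6 Prop. 1.5, Ch. 14
  §0.3 (vi).
-/

noncomputable section

namespace Literature.Dynamics.Homogeneous

open Module
open scoped Matrix Topology
open Literature.AlgebraicGeometry Literature.AlgebraicGeometry.Surfaces

/-! ### Helpers: matrices versus endomorphisms, real matrices acting on complex vectors -/

section Helpers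

open Submodule

/-- Membership in the orthogonal of the frame plane `⟨R, I⟩`: `u ⊥ R` and `u ⊥ I`. [folklore] -/
theorem mem_orthogonal_span_pair_iff (B : LinearMap.BilinForm ℝ (K3Index → ℝ)) (R I u : K3Index → ℝ) :
    u ∈ B.orthogonal (Submodule.span ℝ (Set.range ![R, I])) ↔ B R u = 0 ∧ B I u = 0 := by
  constructor
  · intro hu
    have h := LinearMap.BilinForm.mem_orthogonal_iff.1 hu
    exact ⟨h R (Submodule.subset_span ⟨0, rfl⟩), h I (Submodule.subset_span ⟨1, rfl⟩)⟩
  · rintro ⟨hR, hI⟩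
    refine LinearMap.BilinForm.mem_orthogonal_iff.2 fun n hn => ?_
    obtain ⟨c, rfl⟩ := (Submodule.mem_span_range_iff_exists_fun ℝ).1 hn
    show B _ u = 0
    simp [Fin.sum_univ_two, hR, hI]

/-- Products of generators land in any multiplicatively closed set of matrices containing `1` and
the generators (closure induction through `LinearMap.toMatrix'`). [folklore] -/
theorem toMatrix'_mem_of_mem_closure {P : Set (Matrix K3Index K3Index ℝ)} (h1 : (1 : Matrix _ _ ℝ) ∈ P)
    (hmul : ∀ p ∈ P, ∀ q ∈ P, p * q ∈ P) {s : Set (Module.End ℝ (K3Index → ℝ))}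
    (hs : ∀ g ∈ s, LinearMap.toMatrix' g ∈ P) {g : Module.End ℝ (K3Index → ℝ)}
    (hg : g ∈ Submonoid.closure s) : LinearMap.toMatrix' g ∈ P := by
  induction hg using Submonoid.closure_induction with
  | mem E hE => exact hs E hE
  | one => rw [LinearMap.toMatrix'_one]; exact h1
  | mul E F _ _ ihE ihF => rw [LinearMap.toMatrix'_mul]; exact hmul _ ihE _ ihF

/-- Real part of `p x` for a real matrix `p`: `Re (p x) = p (Re x)`. [folklore] -/
theorem re_map_ofReal_mulVec (p : Matrix K3Index K3Index ℝ) (x : K3Index → ℂ) (i : K3Index) :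
    ((p.map ((↑) : ℝ → ℂ) *ᵥ x) i).re = (p *ᵥ fun j => (x j).re) i := by
  simp [Matrix.mulVec, dotProduct, Complex.re_sum]

/-- Imaginary part of `p x` for a real matrix `p`: `Im (p x) = p (Im x)`. [folklore] -/
theorem im_map_ofReal_mulVec (p : Matrix K3Index K3Index ℝ) (x : K3Index → ℂ) (i : K3Index) :
    ((p.map ((↑) : ℝ → ℂ) *ᵥ x) i).im = (p *ᵥ fun j => (x j).im) i := by
  simp [Matrix.mulVec, dotProduct, Complex.im_sum]

/-- A real matrix mapping the frame of `x` to the frame of `y` maps `x` to `y`. [folklore] -/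
theorem map_ofReal_mulVec_eq_of_frame {p : Matrix K3Index K3Index ℝ} {x y : K3Index → ℂ}
    (hR : (p *ᵥ fun j => (x j).re) = fun j => (y j).re)
    (hI : (p *ᵥ fun j => (x j).im) = fun j => (y j).im) :
    p.map ((↑) : ℝ → ℂ) *ᵥ x = y := by
  funext i
  apply Complex.ext
  · rw [re_map_ofReal_mulVec, hR]
  · rw [im_map_ofReal_mulVec, hI]

end Helpers

/-! ### From a Ratner group containing the Eichler transvections to the frame statement -/

section RatnerGroup

open Submodule

/-- **Case `P = G` (totally irrational planes).** If a multiplicatively closed set `P ∋ 1` of real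
matrices lies in the closure of `SO(Λ_{K3}) · Stab(x)` and contains ALL Eichler transvections,
then every period point `y` with `(Re y)² = (Re x)²` lies in the closure of the `SO(Λ_{K3})`-orbit
of `x`: a product of transvections maps the frame of `x` to the frame of `y`
(`k3Period_exists_mem_closure_eichlerGens_frame`), and limits of `γ h` (`h x = x`) applied to
`x` are limits of orbit points (`mulVec_mem_closure_orbit_of_mem_closure`).
[cite: Verbitsky2017ErgodicErratum, §2.3 (case `S = G`: the orbit of a totally irrational plane is dense)] -/
theorem mem_closure_orbit_of_ratnerGroup_top {x : K3Index → ℂ} (hx : x ∈ k3PeriodDomain)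
    {P : Set (Matrix K3Index K3Index ℝ)} (h1 : (1 : Matrix _ _ ℝ) ∈ P)
    (hmul : ∀ p ∈ P, ∀ q ∈ P, p * q ∈ P)
    (hcl : P ⊆ closure {m : Matrix K3Index K3Index ℝ |
      ∃ (g : Matrix K3Index K3Index ℤ) (h : Matrix K3Index K3Index ℝ),
        g.transpose * k3Gram * g = k3Gram ∧ g.det = 1 ∧
        h.map ((↑) : ℝ → ℂ) *ᵥ x = x ∧ m = g.map (Int.cast : ℤ → ℝ) * h})
    (hgen : ∀ g ∈ eichlerGens (Matrix.toBilin' (k3Gram.map (Int.cast : ℤ → ℝ))) ∅,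
      LinearMap.toMatrix' g ∈ P)
    {y : K3Index → ℂ} (hy : y ∈ k3PeriodDomain)
    (hsq : Matrix.toBilin' (k3Gram.map (Int.cast : ℤ → ℝ)) (fun i => (y i).re) (fun i => (y i).re) =
      Matrix.toBilin' (k3Gram.map (Int.cast : ℤ → ℝ)) (fun i => (x i).re) (fun i => (x i).re)) :
    y ∈ closure {z : K3Index → ℂ | ∃ g : Matrix K3Index K3Index ℤ,
      g.transpose * k3Gram * g = k3Gram ∧ g.det = 1 ∧ z = g.map (Int.cast : ℤ → ℂ) *ᵥ x} := by
  obtain ⟨g, hg, hgR, hgI⟩ := k3Period_exists_mem_closure_eichlerGens_frame rfl hx hy hsq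
  have hp : LinearMap.toMatrix' g ∈ P := toMatrix'_mem_of_mem_closure h1 hmul hgen hg
  have key := mulVec_mem_closure_orbit_of_mem_closure (hcl hp)
  rwa [map_ofReal_mulVec_eq_of_frame (by rw [LinearMap.toMatrix'_mulVec, hgR])
    (by rw [LinearMap.toMatrix'_mulVec, hgI])] at key

/-- **Case `P ⊇ SO⁺(v₀^⊥)` (planes with exactly one rational direction).** Let `P ∋ 1` be a
multiplicatively closed set of real matrices in the closure of `SO(Λ_{K3}) · Stab(x)`, containing
the Eichler transvections orthogonal to a nonzero vector `v₀ = a Re x + b Im x` of the plane of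
`x` and fixing `v₀`, and suppose (output of the BOREL DENSITY THEOREM for the lattice
`Δ = P ∩ SO(Λ_{K3})` of `P`, standard representation) that every vector fixed by the integral
elements of `P` is fixed by those transvections. Then the line `ℝ v₀` is rational (its common
fixed space `Fix(Δ) = ℝ v₀` is spanned by lattice vectors, `…FixedSpaces`), so every period point
`y` with `(Re y)² = (Re x)²` whose frame gives the lattice vectors of the plane of `x` the same
coordinates contains `v₀ = a Re y + b Im y`, and a product of transvections FIXING `v₀` maps the
frame of `x` to that of `y` (`k3Period_exists_mem_closure_eichlerGens_frame_fixing`); hence `y`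
lies in the closure of the orbit of `x`.
[cite: Verbitsky2017ErgodicErratum, §2.3 (case (iii): `S` the stabiliser of a rational vector)] -/
theorem mem_closure_orbit_of_ratnerGroup_line {x : K3Index → ℂ} (hx : x ∈ k3PeriodDomain)
    {P : Set (Matrix K3Index K3Index ℝ)} (h1 : (1 : Matrix _ _ ℝ) ∈ P)
    (hmul : ∀ p ∈ P, ∀ q ∈ P, p * q ∈ P)
    (hcl : P ⊆ closure {m : Matrix K3Index K3Index ℝ |
      ∃ (g : Matrix K3Index K3Index ℤ) (h : Matrix K3Index K3Index ℝ),
        g.transpose * k3Gram * g = k3Gram ∧ g.det = 1 ∧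
        h.map ((↑) : ℝ → ℂ) *ᵥ x = x ∧ m = g.map (Int.cast : ℤ → ℝ) * h})
    {a b : ℝ} (hab : a ≠ 0 ∨ b ≠ 0)
    (hgen : ∀ g ∈ eichlerGens (Matrix.toBilin' (k3Gram.map (Int.cast : ℤ → ℝ)))
      {a • (fun i => (x i).re) + b • (fun i => (x i).im)}, LinearMap.toMatrix' g ∈ P)
    (hfix : ∀ p ∈ P, p *ᵥ (a • (fun i => (x i).re) + b • (fun i => (x i).im)) =
      a • (fun i => (x i).re) + b • (fun i => (x i).im))
    (hBD : ∀ v : K3Index → ℝ,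
      (∀ γ : Matrix K3Index K3Index ℤ, γ.map (Int.cast : ℤ → ℝ) ∈ P →
        γ.map (Int.cast : ℤ → ℝ) *ᵥ v = v) →
      ∀ g ∈ eichlerGens (Matrix.toBilin' (k3Gram.map (Int.cast : ℤ → ℝ)))
        {a • (fun i => (x i).re) + b • (fun i => (x i).im)}, g v = v)
    {y : K3Index → ℂ} (hy : y ∈ k3PeriodDomain)
    (hsq : Matrix.toBilin' (k3Gram.map (Int.cast : ℤ → ℝ)) (fun i => (y i).re) (fun i => (y i).re) =
      Matrix.toBilin' (k3Gram.map (Int.cast : ℤ → ℝ)) (fun i => (x i).re) (fun i => (x i).re))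
    (hcoord : ∀ (v : K3Index → ℤ) (a b : ℝ), (∀ i, (v i : ℝ) = a * (x i).re + b * (x i).im) →
      ∀ i, (v i : ℝ) = a * (y i).re + b * (y i).im) :
    y ∈ closure {z : K3Index → ℂ | ∃ g : Matrix K3Index K3Index ℤ,
      g.transpose * k3Gram * g = k3Gram ∧ g.det = 1 ∧ z = g.map (Int.cast : ℤ → ℂ) *ᵥ x} := by
  set B := Matrix.toBilin' (k3Gram.map (Int.cast : ℤ → ℝ)) with hB
  have hBsymm : B.IsSymm := isSymm_k3RForm
  obtain ⟨h12, h11, hpos⟩ := (mem_k3PeriodDomain_iff_k3RForm hB x).1 hx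
  set R : K3Index → ℝ := fun i => (x i).re with hR
  set I : K3Index → ℝ := fun i => (x i).im with hI
  set v₀ := a • R + b • I with hv₀
  have h21 : B I R = 0 := by rw [k3RForm_comm]; exact h12
  have hn : 0 < a * a + b * b := by
    rcases hab with h | h
    · have := mul_self_pos.2 h; nlinarith [mul_self_nonneg b]
    · have := mul_self_pos.2 h; nlinarith [mul_self_nonneg a]
  have hv₀pos : 0 < B v₀ v₀ := by
    simp only [hv₀, LinearMap.BilinForm.add_left, LinearMap.BilinForm.add_right,
      LinearMap.BilinForm.smul_left, LinearMap.BilinForm.smul_right, h12, h21, ← h11]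
    nlinarith
  have hv₀ne : v₀ ≠ 0 := fun h => by rw [h] at hv₀pos; simp at hv₀pos
  -- the integral elements of `P`
  set Δ : Set (Matrix K3Index K3Index ℤ) := {γ | γ.map (Int.cast : ℤ → ℝ) ∈ P} with hΔ
  -- Step 1: their common fixed space is the line `ℝ v₀`
  have hline : ∀ y' : K3Index → ℝ, (∀ γ ∈ Δ, γ.map (Int.cast : ℤ → ℝ) *ᵥ y' = y') →
      ∃ c : ℝ, y' = c • v₀ := by
    intro y' hy'
    have hE := hBD y' fun γ hγ => hy' γ hγ
    refine (k3_forall_eichlerT_apply_eq_zero_iff hB hv₀pos y').1 fun u w huu huw huv hwv => ?_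
    have hmem : ((1 : Module.End ℝ (K3Index → ℝ)) +
        (LinearMap.smulRight (B u) w - LinearMap.smulRight (B w) u) +
        (2⁻¹ : ℝ) • ((LinearMap.smulRight (B u) w - LinearMap.smulRight (B w) u) *
          (LinearMap.smulRight (B u) w - LinearMap.smulRight (B w) u))) ∈ eichlerGens B {v₀} :=
      ⟨u, w, huu, huw, fun z hz => by rw [Set.mem_singleton_iff.1 hz]; exact huv,
        fun z hz => by rw [Set.mem_singleton_iff.1 hz]; exact hwv, rfl⟩
    exact (eichler_apply_eq_self_iff hBsymm huu huw y').1 (hE _ hmem)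
  have hsub : ∀ y' : K3Index → ℝ, (∀ γ ∈ Δ, γ.map (Int.cast : ℤ → ℝ) *ᵥ y' = y') →
      ∃ a' b' : ℝ, y' = a' • R + b' • I := by
    intro y' hy'
    obtain ⟨c, rfl⟩ := hline y' hy'
    exact ⟨c * a, c * b, by rw [hv₀]; module⟩
  -- Step 2: a lattice vector on the line
  obtain ⟨v, hv0, hvfix, a', b', hvab⟩ := k3_exists_latticeVector_inPlane_of_fixed Δ hsub hv₀ne
    (fun γ hγ => hfix _ hγ)
  have hvfix' : ∀ γ ∈ Δ, γ.map (Int.cast : ℤ → ℝ) *ᵥ (fun i => (v i : ℝ)) = fun i => (v i : ℝ) := by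
    intro γ hγ
    funext i
    rw [← intCast_mulVec_apply, hvfix γ hγ]
  obtain ⟨c, hc⟩ := hline _ hvfix'
  have hc0 : c ≠ 0 := by
    rintro rfl
    rw [zero_smul] at hc
    exact hv0 (funext fun i => by
      have := congr_fun hc i
      simp only [Pi.zero_apply, Int.cast_eq_zero] at this
      simpa using this)
  -- Step 3: the same coordinates in the frame of `y`
  have hvx : ∀ i, (v i : ℝ) = (c * a) * (x i).re + (c * b) * (x i).im := by
    intro i
    have := congr_fun hc i
    simp only [hv₀, Pi.smul_apply, Pi.add_apply, smul_eq_mul] at this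
    rw [this]; ring
  have hvy := hcoord v _ _ hvx
  have hv₀y : v₀ = a • (fun i => (y i).re) + b • (fun i => (y i).im) := by
    have : c • v₀ = c • (a • (fun i => (y i).re) + b • (fun i => (y i).im)) := by
      rw [← hc]
      funext i
      rw [hvy i]
      simp only [Pi.smul_apply, Pi.add_apply, smul_eq_mul]
      ring
    exact smul_right_injective _ hc0 this
  -- Step 4: transport by transvections fixing `v₀`
  obtain ⟨g, hg, hgR, hgI⟩ :=
    k3Period_exists_mem_closure_eichlerGens_frame_fixing hB hx hy hsq hab hv₀y
  have hp : LinearMap.toMatrix' g ∈ P := toMatrix'_mem_of_mem_closure h1 hmul hgen hg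
  have key := mulVec_mem_closure_orbit_of_mem_closure (hcl hp)
  rwa [map_ofReal_mulVec_eq_of_frame (by rw [LinearMap.toMatrix'_mulVec, hgR])
    (by rw [LinearMap.toMatrix'_mulVec, hgI])] at key

end RatnerGroup

/-! ### Case `P ⊆ Stab(P_x)`: the plane is rational -/

section RationalPlane

open Submodule

/-- **From the Borel-density output to the centralizer of `𝔥`.** If a real matrix `X` commutes
with every Eichler transvection orthogonal to the frame `(Re x, Im x)`, then (fixed vectors /
centralizers of unipotents are those of their logarithms, and `Comm` of the isotropic wedges of
`P_x^⊥` is `{scalar on P_x^⊥, preserving P_x}`, `k3_forall_commute_isotropicWedge_iff`) `X` is a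
scalar on `P_x^⊥` and preserves `P_x`. [folklore] -/
theorem k3_scalar_and_preserves_of_commute_eichlerGens {x : K3Index → ℂ} (hx : x ∈ k3PeriodDomain)
    {X : Matrix K3Index K3Index ℝ}
    (hX : ∀ g ∈ eichlerGens (Matrix.toBilin' (k3Gram.map (Int.cast : ℤ → ℝ)))
      {(fun i => (x i).re), (fun i => (x i).im)}, X * LinearMap.toMatrix' g = LinearMap.toMatrix' g * X) :
    (∃ α : ℝ, ∀ v ∈ (Matrix.toBilin' (k3Gram.map (Int.cast : ℤ → ℝ))).orthogonal
        (Submodule.span ℝ (Set.range ![fun i => (x i).re, fun i => (x i).im])),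
        Matrix.toLin' X v = α • v) ∧
      (∀ e ∈ Submodule.span ℝ (Set.range ![fun i => (x i).re, fun i => (x i).im]),
        Matrix.toLin' X e ∈ Submodule.span ℝ (Set.range ![fun i => (x i).re, fun i => (x i).im])) := by
  set B := Matrix.toBilin' (k3Gram.map (Int.cast : ℤ → ℝ)) with hB
  have hBsymm : B.IsSymm := isSymm_k3RForm
  have hBs : ∀ u w, B u w = B w u := fun u w => k3RForm_comm u w
  set R : K3Index → ℝ := fun i => (x i).re with hR
  set I : K3Index → ℝ := fun i => (x i).im with hI
  refine (k3_forall_commute_isotropicWedge_iff hx (Matrix.toLin' X)).1 fun u hu w hw huu huw => ?_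
  rw [← hB] at hu hw huu huw ⊢
  obtain ⟨hRu, hIu⟩ := (mem_orthogonal_span_pair_iff B R I u).1 hu
  obtain ⟨hRw, hIw⟩ := (mem_orthogonal_span_pair_iff B R I w).1 hw
  have hmem : ((1 : Module.End ℝ (K3Index → ℝ)) +
      (LinearMap.smulRight (B u) w - LinearMap.smulRight (B w) u) +
      (2⁻¹ : ℝ) • ((LinearMap.smulRight (B u) w - LinearMap.smulRight (B w) u) *
        (LinearMap.smulRight (B u) w - LinearMap.smulRight (B w) u))) ∈ eichlerGens B {R, I} := by
    refine ⟨u, w, huu, huw, fun z hz => ?_, fun z hz => ?_, rfl⟩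
    · rcases hz with rfl | hz
      · rw [hBs]; exact hRu
      · rw [Set.mem_singleton_iff.1 hz, hBs]; exact hIu
    · rcases hz with rfl | hz
      · rw [hBs]; exact hRw
      · rw [Set.mem_singleton_iff.1 hz, hBs]; exact hIw
  have hc := congr_arg Matrix.toLin' (hX _ hmem)
  rw [Matrix.toLin'_mul, Matrix.toLin'_mul, Matrix.toLin'_toMatrix'] at hc
  have hc' : Matrix.toLin' X * ((1 : Module.End ℝ (K3Index → ℝ)) +
      (LinearMap.smulRight (B u) w - LinearMap.smulRight (B w) u) +
      (2⁻¹ : ℝ) • ((LinearMap.smulRight (B u) w - LinearMap.smulRight (B w) u) *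
        (LinearMap.smulRight (B u) w - LinearMap.smulRight (B w) u))) =
      ((1 : Module.End ℝ (K3Index → ℝ)) +
      (LinearMap.smulRight (B u) w - LinearMap.smulRight (B w) u) +
      (2⁻¹ : ℝ) • ((LinearMap.smulRight (B u) w - LinearMap.smulRight (B w) u) *
        (LinearMap.smulRight (B u) w - LinearMap.smulRight (B w) u))) * Matrix.toLin' X := by
    rw [Module.End.mul_eq_comp, Module.End.mul_eq_comp]; exact hc
  have hT := (commute_eichler_iff hBsymm huu huw (Matrix.toLin' X)).1 hc'
  rw [mul_sub, sub_mul] at hT ⊢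
  calc Matrix.toLin' X * LinearMap.smulRight (B w) u - Matrix.toLin' X * LinearMap.smulRight (B u) w
      = -(Matrix.toLin' X * LinearMap.smulRight (B u) w -
          Matrix.toLin' X * LinearMap.smulRight (B w) u) := by abel
    _ = LinearMap.smulRight (B w) u * Matrix.toLin' X - LinearMap.smulRight (B u) w * Matrix.toLin' X := by
      rw [hT]; abel

/-- **The orthogonal projection onto the plane of a period point** `π v = ((v.R) R + (v.I) I)/(R.R)`:
values in `P_x`, `v − π v ⊥ P_x`, identity on `P_x`, zero on `P_x^⊥`. [folklore] -/
theorem k3_planeProj {x : K3Index → ℂ} (hx : x ∈ k3PeriodDomain) :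
    let B := Matrix.toBilin' (k3Gram.map (Int.cast : ℤ → ℝ))
    let π : Module.End ℝ (K3Index → ℝ) :=
      (B (fun i => (x i).re) (fun i => (x i).re))⁻¹ •
        (LinearMap.smulRight (B fun i => (x i).re) (fun i => (x i).re) +
          LinearMap.smulRight (B fun i => (x i).im) (fun i => (x i).im))
    (∀ v, π v ∈ Submodule.span ℝ (Set.range ![fun i => (x i).re, fun i => (x i).im])) ∧
    (∀ v, v - π v ∈ B.orthogonal (Submodule.span ℝ (Set.range ![fun i => (x i).re, fun i => (x i).im]))) ∧
    (∀ e ∈ Submodule.span ℝ (Set.range ![fun i => (x i).re, fun i => (x i).im]), π e = e) ∧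
    (∀ w ∈ B.orthogonal (Submodule.span ℝ (Set.range ![fun i => (x i).re, fun i => (x i).im])),
      π w = 0) := by
  intro B π
  obtain ⟨h12, h11, hpos⟩ := (mem_k3PeriodDomain_iff_k3RForm (B := B) rfl x).1 hx
  have hBs : ∀ u w, B u w = B w u := fun u w => k3RForm_comm u w
  have h21 : B (fun i => (x i).im) (fun i => (x i).re) = 0 := by rw [hBs]; exact h12
  have hπ : ∀ v, π v =
      ((B (fun i => (x i).re) (fun i => (x i).re))⁻¹ * B (fun i => (x i).re) v) • (fun i => (x i).re) +
      ((B (fun i => (x i).re) (fun i => (x i).re))⁻¹ * B (fun i => (x i).im) v) • (fun i => (x i).im) := by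
    intro v
    simp only [π, LinearMap.smul_apply, LinearMap.add_apply, LinearMap.smulRight_apply, smul_add,
      smul_smul]
  have hRR : B (fun i => (x i).re) (fun i => (x i).re) ≠ 0 := hpos.ne'
  refine ⟨fun v => ?_, fun v => ?_, fun e he => ?_, fun w hw => ?_⟩
  · rw [hπ]
    exact Submodule.add_mem _ (Submodule.smul_mem _ _ (Submodule.subset_span ⟨0, rfl⟩))
      (Submodule.smul_mem _ _ (Submodule.subset_span ⟨1, rfl⟩))
  · rw [mem_orthogonal_span_pair_iff, hπ]
    constructor
    · simp only [LinearMap.BilinForm.sub_right, LinearMap.BilinForm.add_right,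
        LinearMap.BilinForm.smul_right, h12]
      field_simp; ring
    · simp only [LinearMap.BilinForm.sub_right, LinearMap.BilinForm.add_right,
        LinearMap.BilinForm.smul_right, h21, ← h11]
      field_simp; ring
  · obtain ⟨c, rfl⟩ := (Submodule.mem_span_range_iff_exists_fun ℝ).1 he
    simp only [Fin.sum_univ_two, Matrix.cons_val_zero, Matrix.cons_val_one, map_add, map_smul, hπ,
      h12, h21, ← h11]
    have e0 : (B (fun i => (x i).re) (fun i => (x i).re))⁻¹ *
        (c 0 • B (fun i => (x i).re) (fun i => (x i).re) + c 1 • (0 : ℝ)) = c 0 := by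
      rw [smul_eq_mul, smul_zero, add_zero, mul_comm, mul_assoc, mul_inv_cancel₀ hRR, mul_one]
    have e1 : (B (fun i => (x i).re) (fun i => (x i).re))⁻¹ *
        (c 0 • (0 : ℝ) + c 1 • B (fun i => (x i).re) (fun i => (x i).re)) = c 1 := by
      rw [smul_zero, zero_add, smul_eq_mul, mul_comm, mul_assoc, mul_inv_cancel₀ hRR, mul_one]
    rw [e0, e1]
  · obtain ⟨hRw, hIw⟩ := (mem_orthogonal_span_pair_iff B _ _ w).1 hw
    rw [hπ, hRw, hIw, mul_zero, zero_smul, zero_smul, add_zero]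

/-- An isometry of `Λ_{K3} ⊗ ℝ` mapping the plane `P_x` into itself maps `P_x^⊥` into itself
(it is injective, so `δ(P_x) = P_x`). [folklore] -/
theorem k3_orthogonal_map_of_plane_map {x : K3Index → ℂ} {δ : Module.End ℝ (K3Index → ℝ)}
    (hδiso : ∀ u v, Matrix.toBilin' (k3Gram.map (Int.cast : ℤ → ℝ)) (δ u) (δ v) =
      Matrix.toBilin' (k3Gram.map (Int.cast : ℤ → ℝ)) u v)
    (hδP : ∀ e ∈ Submodule.span ℝ (Set.range ![fun i => (x i).re, fun i => (x i).im]),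
      δ e ∈ Submodule.span ℝ (Set.range ![fun i => (x i).re, fun i => (x i).im])) :
    ∀ w ∈ (Matrix.toBilin' (k3Gram.map (Int.cast : ℤ → ℝ))).orthogonal
        (Submodule.span ℝ (Set.range ![fun i => (x i).re, fun i => (x i).im])),
      δ w ∈ (Matrix.toBilin' (k3Gram.map (Int.cast : ℤ → ℝ))).orthogonal
        (Submodule.span ℝ (Set.range ![fun i => (x i).re, fun i => (x i).im])) := by
  set B := Matrix.toBilin' (k3Gram.map (Int.cast : ℤ → ℝ)) with hB
  set Px := Submodule.span ℝ (Set.range ![fun i => (x i).re, fun i => (x i).im]) with hPx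
  have hBn : B.Nondegenerate := k3RForm_nondegenerate
  -- `δ` is injective
  have hinj : Function.Injective δ := by
    rw [← LinearMap.ker_eq_bot, Submodule.eq_bot_iff]
    intro u hu
    rw [LinearMap.mem_ker] at hu
    refine hBn.1 u fun v => ?_
    rw [← hδiso u v, hu, LinearMap.BilinForm.zero_left]
  -- hence `δ(P_x) = P_x`
  have hmap : Px.map δ = Px := by
    refine Submodule.eq_of_le_of_finrank_eq (Submodule.map_le_iff_le_comap.2 fun e he => hδP e he) ?_
    have := LinearEquiv.finrank_map_eq (LinearEquiv.ofInjectiveEndo δ hinj) Px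
    rw [← this]
    rfl
  intro w hw
  refine LinearMap.BilinForm.mem_orthogonal_iff.2 fun n hn => ?_
  rw [← hmap] at hn
  obtain ⟨e, he, rfl⟩ := Submodule.mem_map.1 hn
  show B (δ e) (δ w) = 0
  rw [hδiso]
  exact (LinearMap.BilinForm.mem_orthogonal_iff.1 hw) e he

/-- **Rational eigenvalue on `P_x^⊥`.** If an integral matrix acts on the `20`-dimensional
`P_x^⊥` by the scalar `α`, then `α ∈ ℚ` (an eigenvalue of a rational `22 × 22` matrix with
eigenspace of dimension `> 11`, `exists_ratCast_eq_of_lt_two_mul_finrank_ker`). [folklore] -/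
theorem k3_exists_ratCast_of_scalar_on_orthogonal {x : K3Index → ℂ} (hx : x ∈ k3PeriodDomain)
    {Z : Matrix K3Index K3Index ℤ} {α : ℝ}
    (hα : ∀ v ∈ (Matrix.toBilin' (k3Gram.map (Int.cast : ℤ → ℝ))).orthogonal
        (Submodule.span ℝ (Set.range ![fun i => (x i).re, fun i => (x i).im])),
        Z.map (Int.cast : ℤ → ℝ) *ᵥ v = α • v) :
    ∃ q : ℚ, (q : ℝ) = α := by
  set B := Matrix.toBilin' (k3Gram.map (Int.cast : ℤ → ℝ)) with hB
  set Px := Submodule.span ℝ (Set.range ![fun i => (x i).re, fun i => (x i).im]) with hPx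
  have hBn : B.Nondegenerate := k3RForm_nondegenerate
  refine exists_ratCast_eq_of_lt_two_mul_finrank_ker (Z.map (Int.cast : ℤ → ℚ)) α ?_
  have hZ : (Z.map (Int.cast : ℤ → ℚ)).map (algebraMap ℚ ℝ) = Z.map (Int.cast : ℤ → ℝ) := by
    ext i j; simp [Matrix.map_apply]
  have hle : B.orthogonal Px ≤ LinearMap.ker (Matrix.mulVecLin
      ((Z.map (Int.cast : ℤ → ℚ)).map (algebraMap ℚ ℝ) - Matrix.scalar K3Index α)) := by
    intro v hv
    rw [LinearMap.mem_ker, mulVecLin_sub_scalar_eq_zero_iff, hZ]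
    exact hα v hv
  have h20 : finrank ℝ (B.orthogonal Px) = 20 := by
    rw [LinearMap.BilinForm.finrank_orthogonal hBn, finrank_k3Plane hx,
      Module.finrank_fintype_fun_eq_card]
    simp [Fintype.card_sum, Fintype.card_fin]
  have := Submodule.finrank_mono hle
  have hcard : Fintype.card K3Index = 22 := by simp [Fintype.card_sum, Fintype.card_fin]
  omega

/-- Isometries from the matrix identity `pᵀ G p = G`. [folklore] -/
theorem k3RForm_mulVec_mulVec_of_transpose_mul {p : Matrix K3Index K3Index ℝ}
    (hp : p.transpose * k3Gram.map (Int.cast : ℤ → ℝ) * p = k3Gram.map (Int.cast : ℤ → ℝ))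
    (u w : K3Index → ℝ) :
    Matrix.toBilin' (k3Gram.map (Int.cast : ℤ → ℝ)) (p *ᵥ u) (p *ᵥ w) =
      Matrix.toBilin' (k3Gram.map (Int.cast : ℤ → ℝ)) u w := by
  rw [Matrix.toBilin'_apply', Matrix.toBilin'_apply', Matrix.mulVec_mulVec,
    ← Matrix.vecMul_transpose p u, ← Matrix.dotProduct_mulVec, Matrix.mulVec_mulVec,
    ← Matrix.mul_assoc, hp]

/-- Fixed vectors of `1 + N`: `(1 + N) y = y ↔ N y = 0` (real form for an integral `N`).
[folklore] -/
theorem map_one_add_mulVec_eq_self_iff (N : Matrix K3Index K3Index ℤ) (y : K3Index → ℝ) :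
    (1 + N).map (Int.cast : ℤ → ℝ) *ᵥ y = y ↔ N.map (Int.cast : ℤ → ℝ) *ᵥ y = 0 := by
  have : (1 + N).map (Int.cast : ℤ → ℝ) = 1 + N.map (Int.cast : ℤ → ℝ) := by
    ext i j
    simp only [Matrix.map_apply, Matrix.add_apply, Matrix.one_apply, Int.cast_add]
    split_ifs <;> simp
  rw [this, Matrix.add_mulVec, Matrix.one_mulVec, add_eq_left]

/-- `(d Z − n 1) y = d (Z y) − n y` (real form for an integral `Z`). [folklore] -/
theorem map_zsmul_sub_mulVec (Z : Matrix K3Index K3Index ℤ) (d n : ℤ) (y : K3Index → ℝ) :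
    ((d • Z - n • (1 : Matrix K3Index K3Index ℤ)).map (Int.cast : ℤ → ℝ)) *ᵥ y =
      (d : ℝ) • (Z.map (Int.cast : ℤ → ℝ) *ᵥ y) - (n : ℝ) • y := by
  have : (d • Z - n • (1 : Matrix K3Index K3Index ℤ)).map (Int.cast : ℤ → ℝ) =
      (d : ℝ) • Z.map (Int.cast : ℤ → ℝ) - (n : ℝ) • (1 : Matrix K3Index K3Index ℝ) := by
    ext i j
    simp only [Matrix.map_apply, Matrix.sub_apply, Matrix.smul_apply, Matrix.one_apply, smul_eq_mul,
      Int.cast_sub, Int.cast_mul]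
    split_ifs <;> simp
  rw [this, Matrix.sub_mulVec, Matrix.smul_mulVec, Matrix.smul_mulVec, Matrix.one_mulVec]

/-- The rank-one integral matrix `a ⊗ b` acts by `y ↦ (b . y) a`. [folklore] -/
theorem map_vecMulVec_mulVec (a b : K3Index → ℤ) (y : K3Index → ℝ) :
    ((Matrix.vecMulVec a b).map (Int.cast : ℤ → ℝ)) *ᵥ y =
      (∑ j, (b j : ℝ) * y j) • fun i => (a i : ℝ) := by
  ext i
  simp only [Matrix.mulVec, dotProduct, Matrix.map_apply, Matrix.vecMulVec_apply, Pi.smul_apply,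
    smul_eq_mul, Int.cast_mul]
  rw [Finset.sum_mul]
  exact Finset.sum_congr rfl fun j _ => by ring

/-- Pairing with a lattice vector through the row `v G`: `(v_ℝ . y) = Σ_j (vG)_j y_j`. [folklore] -/
theorem k3RForm_intCast_left (v : K3Index → ℤ) (y : K3Index → ℝ) :
    Matrix.toBilin' (k3Gram.map (Int.cast : ℤ → ℝ)) (fun i => (v i : ℝ)) y =
      ∑ j, ((v ᵥ* k3Gram) j : ℝ) * y j := by
  rw [k3RForm_apply, Finset.sum_comm]
  refine Finset.sum_congr rfl fun j _ => ?_
  rw [Matrix.vecMul, dotProduct]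
  push_cast
  rw [Finset.sum_mul]

/-- **Case `P ⊆ Stab(P_x)` (rational planes).** Let `P` be a set of isometries of `Λ_{K3} ⊗ ℝ`
mapping the plane `P_x = ⟨Re x, Im x⟩` of a period point into itself, and suppose (output of the
BOREL DENSITY THEOREM for the lattice `Δ = P ∩ SO(Λ_{K3})` of `P`, conjugation representation)
that every real matrix commuting with the integral elements of `P` commutes with the Eichler
transvections orthogonal to the frame. Then `P_x` is a RATIONAL plane. Proof: the orthogonal
projection `π` onto `P_x` commutes with `Δ` (`Δ` preserves `P_x` and `P_x^⊥`), so lies in the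
real span of the INTEGRAL matrices commuting with `Δ` (`mem_span_intCommutant_of_forall_commute`);
each of these is, by the hypothesis and `k3_forall_commute_isotropicWedge_iff`, a scalar `α` on
the `20`-dimensional `P_x^⊥`, with `α ∈ ℚ` (`exists_ratCast_eq_of_lt_two_mul_finrank_ker`);
expanding `π` shows that `P_x^⊥` is exactly the common kernel of finitely many integral matrices
`d Z − n`, hence spanned by lattice vectors (`mem_span_latticeFixed_of_forall_mulVec_eq`), and then
`P_x = (P_x^⊥)^⊥` is the common fixed space of the integral matrices `1 + e ⊗ (vG)`, so it is
rational (`k3_isRationalPlane_of_fixedSpace_eq_plane`).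
[cite: Verbitsky2017ErgodicErratum, §2.3 (case `S = H`: the orbit is closed and the plane rational)] -/
theorem k3_isRationalPlane_of_ratnerGroup_plane {x : K3Index → ℂ} (hx : x ∈ k3PeriodDomain)
    {P : Set (Matrix K3Index K3Index ℝ)}
    (hiso : ∀ p ∈ P, p.transpose * k3Gram.map (Int.cast : ℤ → ℝ) * p = k3Gram.map (Int.cast : ℤ → ℝ))
    (hpres : ∀ p ∈ P, ∀ e ∈ Submodule.span ℝ (Set.range ![fun i => (x i).re, fun i => (x i).im]),
      p *ᵥ e ∈ Submodule.span ℝ (Set.range ![fun i => (x i).re, fun i => (x i).im]))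
    (hBD : ∀ X : Matrix K3Index K3Index ℝ,
      (∀ γ : Matrix K3Index K3Index ℤ, γ.map (Int.cast : ℤ → ℝ) ∈ P →
        X * γ.map (Int.cast : ℤ → ℝ) = γ.map (Int.cast : ℤ → ℝ) * X) →
      ∀ g ∈ eichlerGens (Matrix.toBilin' (k3Gram.map (Int.cast : ℤ → ℝ)))
        {(fun i => (x i).re), (fun i => (x i).im)},
        X * LinearMap.toMatrix' g = LinearMap.toMatrix' g * X) :
    ∃ (u w : K3Index → ℤ) (a b c d : ℝ), ∀ i,
      (x i).re = a * u i + b * w i ∧ (x i).im = c * u i + d * w i := by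
  set B := Matrix.toBilin' (k3Gram.map (Int.cast : ℤ → ℝ)) with hB
  set Px := Submodule.span ℝ (Set.range ![fun i => (x i).re, fun i => (x i).im]) with hPx
  set W := B.orthogonal Px with hW
  have hBn : B.Nondegenerate := k3RForm_nondegenerate
  have hBsymm : B.IsSymm := isSymm_k3RForm
  have hBs : ∀ u w, B u w = B w u := fun u w => k3RForm_comm u w
  obtain ⟨h12, h11, hpos⟩ := (mem_k3PeriodDomain_iff_k3RForm hB x).1 hx
  obtain ⟨hπP, hπW, hπid, hπ0⟩ := k3_planeProj hx
  set π : Module.End ℝ (K3Index → ℝ) :=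
    (B (fun i => (x i).re) (fun i => (x i).re))⁻¹ •
      (LinearMap.smulRight (B fun i => (x i).re) (fun i => (x i).re) +
        LinearMap.smulRight (B fun i => (x i).im) (fun i => (x i).im)) with hπdef
  set Δ : Set (Matrix K3Index K3Index ℤ) := {γ | γ.map (Int.cast : ℤ → ℝ) ∈ P} with hΔ
  -- Step 1: `π` commutes with `Δ`
  have hcomm : ∀ γ ∈ Δ, LinearMap.toMatrix' π * γ.map (Int.cast : ℤ → ℝ) =
      γ.map (Int.cast : ℤ → ℝ) * LinearMap.toMatrix' π := by
    intro γ hγ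
    set δ := Matrix.toLin' (γ.map (Int.cast : ℤ → ℝ)) with hδ
    have hδiso : ∀ u v, B (δ u) (δ v) = B u v := fun u v => by
      rw [hδ, Matrix.toLin'_apply, Matrix.toLin'_apply]
      exact k3RForm_mulVec_mulVec_of_transpose_mul (hiso _ hγ) u v
    have hδP : ∀ e ∈ Px, δ e ∈ Px := fun e he => by
      rw [hδ, Matrix.toLin'_apply]; exact hpres _ hγ e he
    have hδW := k3_orthogonal_map_of_plane_map hδiso hδP
    have hEnd : π * δ = δ * π := by
      refine LinearMap.ext fun v => ?_
      rw [Module.End.mul_apply, Module.End.mul_apply]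
      conv_lhs => rw [show v = π v + (v - π v) by abel]
      rw [map_add, map_add, hπid _ (hδP _ (hπP v)), hπ0 _ (hδW _ (hπW v)), add_zero]
    have := congr_arg LinearMap.toMatrix' hEnd
    rwa [LinearMap.toMatrix'_mul, LinearMap.toMatrix'_mul, hδ, LinearMap.toMatrix'_toLin'] at this
  -- Step 2: `π` is a real combination of integral matrices commuting with `Δ`
  obtain ⟨f, t, ht, -, hsum⟩ := Submodule.mem_span_iff_exists_finset_subset.1
    (mem_span_intCommutant_of_forall_commute Δ hcomm)
  -- Step 3: each of them is a rational scalar on `W`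
  have hdata : ∀ a : Matrix K3Index K3Index ℝ, ∃ (Z : Matrix K3Index K3Index ℤ) (q : ℚ),
      a ∈ t → a = Z.map (Int.cast : ℤ → ℝ) ∧ ∀ v ∈ W, a *ᵥ v = (q : ℝ) • v := by
    intro a
    by_cases ha : a ∈ t
    · obtain ⟨Z, hZ, rfl⟩ := ht ha
      have hZcomm : ∀ γ : Matrix K3Index K3Index ℤ, γ.map (Int.cast : ℤ → ℝ) ∈ P →
          Z.map (Int.cast : ℤ → ℝ) * γ.map (Int.cast : ℤ → ℝ) =
            γ.map (Int.cast : ℤ → ℝ) * Z.map (Int.cast : ℤ → ℝ) := by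
        intro γ hγ
        rw [← Matrix.map_mul_intCast, ← Matrix.map_mul_intCast, hZ γ hγ]
      obtain ⟨⟨α, hα⟩, -⟩ := k3_scalar_and_preserves_of_commute_eichlerGens hx (hBD _ hZcomm)
      have hα' : ∀ v ∈ W, Z.map (Int.cast : ℤ → ℝ) *ᵥ v = α • v := fun v hv => by
        rw [← Matrix.toLin'_apply]; exact hα v hv
      obtain ⟨q, hq⟩ := k3_exists_ratCast_of_scalar_on_orthogonal hx hα'
      exact ⟨Z, q, fun _ => ⟨rfl, fun v hv => by rw [hq]; exact hα' v hv⟩⟩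
    · exact ⟨0, 0, fun h => (ha h).elim⟩
  choose Z q hZq using hdata
  -- Step 4: `W` is the common eigenspace
  have hπy : ∀ y, π y = ∑ a ∈ t, f a • (a *ᵥ y) := by
    intro y
    rw [← Matrix.toLin'_toMatrix' π, ← hsum, map_sum]
    simp only [map_smul, LinearMap.sum_apply, LinearMap.smul_apply, Matrix.toLin'_apply]
  have h20 : finrank ℝ W = 20 := by
    rw [hW, LinearMap.BilinForm.finrank_orthogonal hBn, finrank_k3Plane hx,
      Module.finrank_fintype_fun_eq_card]
    simp [Fintype.card_sum, Fintype.card_fin]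
  obtain ⟨w₀, hw₀, hw₀0⟩ : ∃ w₀ ∈ W, w₀ ≠ 0 :=
    (Submodule.ne_bot_iff _).1 fun h => by rw [h, finrank_bot] at h20; exact absurd h20 (by norm_num)
  have hsum0 : ∑ a ∈ t, f a * (q a : ℝ) = 0 := by
    have h0 := hπ0 w₀ hw₀
    rw [hπy] at h0
    have : ∑ a ∈ t, f a • (a *ᵥ w₀) = (∑ a ∈ t, f a * (q a : ℝ)) • w₀ := by
      rw [Finset.sum_smul]
      refine Finset.sum_congr rfl fun a ha => ?_
      rw [((hZq a) ha).2 w₀ hw₀, smul_smul]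
    rw [this] at h0
    exact (smul_eq_zero.1 h0).resolve_right hw₀0
  have hWchar : ∀ y : K3Index → ℝ, (∀ a ∈ t, a *ᵥ y = (q a : ℝ) • y) → y ∈ W := by
    intro y hy
    have hπy0 : π y = 0 := by
      rw [hπy]
      have : ∑ a ∈ t, f a • (a *ᵥ y) = (∑ a ∈ t, f a * (q a : ℝ)) • y := by
        rw [Finset.sum_smul]
        refine Finset.sum_congr rfl fun a ha => ?_
        rw [hy a ha, smul_smul]
      rw [this, hsum0, zero_smul]
    have := hπW y
    rwa [hπy0, sub_zero] at this
  -- Step 5: `W` is the common fixed space of finitely many integral matrices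
  set Δ₂ : Set (Matrix K3Index K3Index ℤ) :=
    {M | ∃ a ∈ t, M = 1 + (((q a).den : ℤ) • Z a - (q a).num • (1 : Matrix K3Index K3Index ℤ))}
    with hΔ₂
  have hqa : ∀ a, ((q a).den : ℝ) * (q a : ℝ) = ((q a).num : ℝ) := fun a => by
    rw [mul_comm]; exact_mod_cast Rat.mul_den_eq_num (q a)
  have hfixW : ∀ y ∈ W, ∀ M ∈ Δ₂, M.map (Int.cast : ℤ → ℝ) *ᵥ y = y := by
    rintro y hy M ⟨a, ha, rfl⟩
    rw [map_one_add_mulVec_eq_self_iff, map_zsmul_sub_mulVec, ← ((hZq a) ha).1,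
      ((hZq a) ha).2 y hy, smul_smul, Int.cast_natCast, hqa, sub_self]
  have hWfix : ∀ y : K3Index → ℝ, (∀ M ∈ Δ₂, M.map (Int.cast : ℤ → ℝ) *ᵥ y = y) → y ∈ W := by
    intro y hy
    refine hWchar y fun a ha => ?_
    have h := hy _ ⟨a, ha, rfl⟩
    rw [map_one_add_mulVec_eq_self_iff, map_zsmul_sub_mulVec, ← ((hZq a) ha).1, sub_eq_zero,
      Int.cast_natCast] at h
    have hd : ((q a).den : ℝ) ≠ 0 := by exact_mod_cast (q a).den_nz
    have := congr_arg (fun z => ((q a).den : ℝ)⁻¹ • z) h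
    simp only [smul_smul, inv_mul_cancel₀ hd, one_smul] at this
    rw [this, ← hqa, ← mul_assoc, inv_mul_cancel₀ hd, one_mul]
  -- Step 6: `W` is spanned by lattice vectors, and `P_x = W^⊥` is the fixed space of the
  -- integral matrices `1 + e ⊗ (vG)`, `v` a lattice vector of `W`
  set i₀ : K3Index := Sum.inr (Sum.inl 0) with hi₀
  set Δ₃ : Set (Matrix K3Index K3Index ℤ) :=
    {M | ∃ v : K3Index → ℤ, (∀ g ∈ Δ₂, g *ᵥ v = v) ∧
      M = 1 + Matrix.vecMulVec (Pi.single i₀ 1) (v ᵥ* k3Gram)} with hΔ₃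
  have hlatW : ∀ v : K3Index → ℤ, (∀ g ∈ Δ₂, g *ᵥ v = v) → (fun i => (v i : ℝ)) ∈ W := by
    intro v hv
    refine hWfix _ fun M hM => ?_
    funext i
    rw [← intCast_mulVec_apply, hv M hM]
  have hfix₃ : ∀ (v : K3Index → ℤ) (y : K3Index → ℝ),
      (1 + Matrix.vecMulVec (Pi.single i₀ 1) (v ᵥ* k3Gram)).map (Int.cast : ℤ → ℝ) *ᵥ y = y ↔
        B (fun i => (v i : ℝ)) y = 0 := by
    intro v y
    rw [map_one_add_mulVec_eq_self_iff, map_vecMulVec_mulVec, ← k3RForm_intCast_left, smul_eq_zero]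
    constructor
    · rintro (h | h)
      · exact h
      · exfalso
        have := congr_fun h i₀
        simp [hi₀] at this
    · exact fun h => Or.inl h
  refine k3_isRationalPlane_of_fixedSpace_eq_plane hx Δ₃ (fun y hy => ?_) (fun M hM => ?_)
    (fun M hM => ?_)
  · -- `y ⊥ W`, hence `y ∈ P_x`
    have hyW : ∀ w ∈ W, B w y = 0 := by
      intro w hw
      have hspan := mem_span_latticeFixed_of_forall_mulVec_eq Δ₂ (hfixW w hw)
      have hle : Submodule.span ℝ {u : K3Index → ℝ | ∃ v : K3Index → ℤ,
          (∀ g ∈ Δ₂, g *ᵥ v = v) ∧ u = fun i => (v i : ℝ)} ≤ LinearMap.ker (B.flip y) := by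
        refine Submodule.span_le.2 ?_
        rintro _ ⟨v, hv, rfl⟩
        rw [SetLike.mem_coe, LinearMap.mem_ker, LinearMap.BilinForm.flip_apply]
        exact (hfix₃ v y).1 (hy _ ⟨v, hv, rfl⟩)
      have := hle hspan
      rwa [LinearMap.mem_ker, LinearMap.BilinForm.flip_apply] at this
    have hyP : y ∈ Px := by
      have : y ∈ B.orthogonal W := LinearMap.BilinForm.mem_orthogonal_iff.2 fun w hw => hyW w hw
      rwa [hW, LinearMap.BilinForm.orthogonal_orthogonal hBn hBsymm.isRefl] at this
    obtain ⟨c, rfl⟩ := (Submodule.mem_span_range_iff_exists_fun ℝ).1 hyP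
    exact ⟨c 0, c 1, by simp [Fin.sum_univ_two]⟩
  · obtain ⟨v, hv, rfl⟩ := hM
    rw [hfix₃, hBs]
    exact (LinearMap.BilinForm.mem_orthogonal_iff.1 (hlatW v hv)) _ (Submodule.subset_span ⟨0, rfl⟩)
  · obtain ⟨v, hv, rfl⟩ := hM
    rw [hfix₃, hBs]
    exact (LinearMap.BilinForm.mem_orthogonal_iff.1 (hlatW v hv)) _ (Submodule.subset_span ⟨1, rfl⟩)

end RationalPlane

/-! ### The reduction: `Verbitsky2017_orbitClosure_trichotomy_K3` from the structure of the
Ratner group of the frame -/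

section Reduction

/-- **Verbitsky's orbit-closure trichotomy for `Λ_{K3}` from the structure of the Ratner group
of the frame** — the assembly of the erratum's proof [Verbitsky2017ErgodicErratum, §2.3] with
ALL of its problem-specific content proved in the tree, leaving as hypothesis exactly what the
four classical theorems deliver. For a period point `x ∈ D` with frame `(R, I) = (Re x, Im x)`,
plane `P_x = ⟨R, I⟩`, `G = O(Λ_{K3} ⊗ ℝ)`, `Γ = SO(Λ_{K3})` and `H° ⊆ G` the subgroup generated
by the Eichler flows `t ↦ exp(t T_{u,w})` (`u, w ⊥ P_x`; `H° = SO⁺(P_x^⊥) ≅ SO⁺(1,19)`,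
generated by unipotent one-parameter subgroups), the hypothesis `hR` asks for a set `P` of real
matrices — the RATNER GROUP of `H°` at the identity coset — such that

* `1 ∈ P`, `P P ⊆ P`, `P ⊆ G` (isometries), and `P ⊆ cl(Γ · Stab(x))` — RATNER'S ORBIT-CLOSURE
  THEOREM [Morris2005Ratner, Thm. 1.1.14 with Rem. 1.1.15 (2)–(3) and Rem. 1.1.19; Ratner 1991]
  applied to the lattice `Γ` of `G` (BOREL–HARISH-CHANDRA [Morris2005Ratner, §4.8;
  BorelHarishchandra1962]) and `H°`: `cl(Γ H°) = Γ P` for a closed connected subgroup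
  `H° ≤ P ≤ G` with `Δ = P ∩ Γ` a lattice in `P`; and
* ONE of three structural alternatives for `P` relative to the frame:
  (A) `P` contains every Eichler transvection; or
  (B) for some nonzero `v₀ = a R + b I ∈ P_x`: `P` contains the Eichler transvections orthogonal
      to `v₀`, fixes `v₀`, and every vector fixed by the integral elements `Δ` of `P` is fixed by
      those transvections; or
  (C) `P` maps `P_x` into itself, and every real matrix commuting with `Δ` commutes with the
      Eichler transvections orthogonal to `P_x`.
  These come from: the LIE CORRESPONDENCE for the closed subgroup `P ≤ GL₂₂(ℝ)` (`𝔭 = Lie P` is a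
  subalgebra with `𝔥 = 𝔰𝔬(P_x^⊥) ⊆ 𝔭 ⊆ 𝔰𝔬(3,19)` and `P = ⟨exp 𝔭⟩`, `P` being connected); the
  CLASSIFICATION of such subalgebras PROVED in `…Subalgebras`
  (`Verbitsky2017_lieSubalgebra_containing_so_orthogonal`: `𝔭 = 𝔥`, `𝔥 ⊕ 𝔰𝔬(P_x)`,
  `𝔰𝔬(v₀^⊥)` or `𝔰𝔬(3,19)` — erratum §2.1), giving (C), (C), (B), (A) respectively since
  `exp T_{u,w} = E_{u,w}` (`T³ = 0`); and the BOREL DENSITY THEOREM [Morris2005Ratner, §4.7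
  (4.7.1); Borel1960] for the lattice `Δ` of `P` in the standard representation (B) and in the
  conjugation representation on `M₂₂(ℝ)` (C): `Δ`-fixed vectors are fixed by every unipotent
  element of `P`, in particular by the Eichler transvections that `P` contains (`P ⊇ H°` always).

CONCLUSION, proved here from the landed glue: in case (A) transitivity of the transvections on
frames (`…Transvections`) and the orbit-map bookkeeping give `cl(Γ·x) ⊇ {y ∈ D : (Re y)² = (Re x)²}`
(`mem_closure_orbit_of_ratnerGroup_top`); in case (B) the line `ℝ v₀ = Fix(Δ)` is rational
(`…FixedSpaces`, `k3_forall_eichlerT_apply_eq_zero_iff`) and transvections fixing `v₀` reach every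
admissible frame (`mem_closure_orbit_of_ratnerGroup_line`); in case (C) the plane `P_x` is rational
(`k3_isRationalPlane_of_ratnerGroup_plane`, via `…Commutant`) and the frame statement holds
trivially (`frameOrbitClosure_of_rationalPlane`). Hence the frame statement `hframe` of
`Verbitsky2017_orbitClosure_trichotomy_K3_of_frameOrbitClosure`, hence the fact. What separates
this theorem from `Verbitsky2017_orbitClosure_trichotomy_K3_holds` is therefore precisely:
Ratner's orbit-closure theorem, Borel–Harish-Chandra, the Borel density theorem and the Lie
correspondence for closed subgroups of `GL₂₂(ℝ)` — none of which is in Mathlib or `Literature/`.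
[cite: Verbitsky2017ErgodicErratum, §2.3 (proof of the Theorem), §2.2 (Ratner's theorem for `H ⊂ G`), §2.1 (the subalgebras)] -/
theorem Verbitsky2017_orbitClosure_trichotomy_K3_of_ratnerGroup
    (hR : ∀ x : K3Index → ℂ, x ∈ k3PeriodDomain →
      ∃ P : Set (Matrix K3Index K3Index ℝ),
        (1 : Matrix K3Index K3Index ℝ) ∈ P ∧ (∀ p ∈ P, ∀ q ∈ P, p * q ∈ P) ∧
        (∀ p ∈ P, p.transpose * k3Gram.map (Int.cast : ℤ → ℝ) * p = k3Gram.map (Int.cast : ℤ → ℝ)) ∧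
        P ⊆ closure {m : Matrix K3Index K3Index ℝ |
          ∃ (g : Matrix K3Index K3Index ℤ) (h : Matrix K3Index K3Index ℝ),
            g.transpose * k3Gram * g = k3Gram ∧ g.det = 1 ∧
            h.map ((↑) : ℝ → ℂ) *ᵥ x = x ∧ m = g.map (Int.cast : ℤ → ℝ) * h} ∧
        ((∀ g ∈ eichlerGens (Matrix.toBilin' (k3Gram.map (Int.cast : ℤ → ℝ))) ∅,
            LinearMap.toMatrix' g ∈ P) ∨
         (∃ a b : ℝ, (a ≠ 0 ∨ b ≠ 0) ∧
            (∀ g ∈ eichlerGens (Matrix.toBilin' (k3Gram.map (Int.cast : ℤ → ℝ)))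
              {a • (fun i => (x i).re) + b • (fun i => (x i).im)}, LinearMap.toMatrix' g ∈ P) ∧
            (∀ p ∈ P, p *ᵥ (a • (fun i => (x i).re) + b • (fun i => (x i).im)) =
              a • (fun i => (x i).re) + b • (fun i => (x i).im)) ∧
            (∀ v : K3Index → ℝ,
              (∀ γ : Matrix K3Index K3Index ℤ, γ.map (Int.cast : ℤ → ℝ) ∈ P →
                γ.map (Int.cast : ℤ → ℝ) *ᵥ v = v) →
              ∀ g ∈ eichlerGens (Matrix.toBilin' (k3Gram.map (Int.cast : ℤ → ℝ)))
                {a • (fun i => (x i).re) + b • (fun i => (x i).im)}, g v = v)) ∨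
         ((∀ p ∈ P, ∀ e ∈ Submodule.span ℝ (Set.range ![fun i => (x i).re, fun i => (x i).im]),
              p *ᵥ e ∈ Submodule.span ℝ (Set.range ![fun i => (x i).re, fun i => (x i).im])) ∧
            (∀ X : Matrix K3Index K3Index ℝ,
              (∀ γ : Matrix K3Index K3Index ℤ, γ.map (Int.cast : ℤ → ℝ) ∈ P →
                X * γ.map (Int.cast : ℤ → ℝ) = γ.map (Int.cast : ℤ → ℝ) * X) →
              ∀ g ∈ eichlerGens (Matrix.toBilin' (k3Gram.map (Int.cast : ℤ → ℝ)))
                {(fun i => (x i).re), (fun i => (x i).im)},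
                X * LinearMap.toMatrix' g = LinearMap.toMatrix' g * X)))) :
    Verbitsky2017_orbitClosure_trichotomy_K3 :=
  Verbitsky2017_orbitClosure_trichotomy_K3_of_frameOrbitClosure fun x hx y hy hsq hcoord => by
    obtain ⟨P, h1, hmul, hiso, hcl, hA | ⟨a, b, hab, hgen, hfix, hBD⟩ | ⟨hpres, hBD⟩⟩ := hR x hx
    · exact mem_closure_orbit_of_ratnerGroup_top hx h1 hmul hcl hA hy hsq
    · exact mem_closure_orbit_of_ratnerGroup_line hx h1 hmul hcl hab hgen hfix hBD hy hsq hcoord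
    · exact frameOrbitClosure_of_rationalPlane hx
        (k3_isRationalPlane_of_ratnerGroup_plane hx hiso hpres hBD) hcoord

end Reduction

/-! ### Eichler flows `t ↦ exp(t T_{u,w})` are the unipotent one-parameter subgroups with
values in the Eichler transvections (bridge to renderings of Ratner's theorem via `IsNilpotent.exp`) -/

section ExpBridge

variable {n : Type*} [Fintype n] [DecidableEq n] {B : LinearMap.BilinForm ℝ (n → ℝ)}

/-- Scaling the second vector scales the Eichler map: `T_{u, t w} = t T_{u,w}`. This is
`SkewPlane.bwedge_smul_left B t w u` (`OrthogonalGroupOrbitClosuresSubalgebras.lean`; the Eichler map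
`T_{u,w}` is the wedge `ω⟦B; w, u⟧` on the nose), kept as a deprecated alias. [folklore] -/
@[deprecated SkewPlane.bwedge_smul_left (since := "2026-08-16")]
alias eichlerT_smul := SkewPlane.bwedge_smul_left

/-- **The Eichler flow is the exponential of the Eichler map** (matrix form, `IsNilpotent.exp` =
the finite exponential sum of Morris's unipotent one-parameter subgroups): for `u` isotropic and
`w ⊥ u`, `exp(t [T_{u,w}]) = [E_{u, t w}] = [1 + T_{u,tw} + ½ T_{u,tw}²]` (`T³ = 0`). So the
unipotent one-parameter subgroups `t ↦ exp(t T_{u,w})` generating `SO⁺` take values in (the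
matrices of) `eichlerGens`, and conversely every Eichler transvection is such a value. [folklore] -/
theorem exp_smul_toMatrix_eichlerT (hB : B.IsSymm) {u w : n → ℝ} (huu : B u u = 0) (huw : B u w = 0)
    (t : ℝ) :
    IsNilpotent.exp (t • LinearMap.toMatrix'
        (LinearMap.smulRight (B u) w - LinearMap.smulRight (B w) u : Module.End ℝ (n → ℝ))) =
      LinearMap.toMatrix' ((1 : Module.End ℝ (n → ℝ)) +
        (LinearMap.smulRight (B u) (t • w) - LinearMap.smulRight (B (t • w)) u) +
        (2⁻¹ : ℝ) • ((LinearMap.smulRight (B u) (t • w) - LinearMap.smulRight (B (t • w)) u) *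
          (LinearMap.smulRight (B u) (t • w) - LinearMap.smulRight (B (t • w)) u))) := by
  set T : Module.End ℝ (n → ℝ) := LinearMap.smulRight (B u) w - LinearMap.smulRight (B w) u with hT
  have h3 : (t • LinearMap.toMatrix' T) ^ 3 = 0 := by
    rw [smul_pow, pow_three (LinearMap.toMatrix' T), ← LinearMap.toMatrix'_mul, ← LinearMap.toMatrix'_mul,
      ← pow_three, hT,
      eichlerT_pow_three hB huu huw, map_zero, smul_zero]
  rw [IsNilpotent.exp_eq_sum h3, SkewPlane.bwedge_smul_left, ← hT]
  simp only [Finset.sum_range_succ, Finset.sum_range_zero, zero_add, pow_zero, pow_one,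
    Nat.factorial_zero, Nat.factorial_one, Nat.factorial_two, Nat.cast_one, inv_one, one_smul,
    map_add, LinearMap.toMatrix'_one, map_smul, LinearMap.toMatrix'_mul, smul_mul_smul, pow_two]
  congr 1
  rw [show ((2 : ℕ) : ℚ)⁻¹ = ((2⁻¹ : ℚ)) by norm_num, ← Rat.cast_smul_eq_qsmul ℝ (2⁻¹ : ℚ),
    Rat.cast_inv, Rat.cast_ofNat]

/-- Membership form: the values of an Eichler flow orthogonal to `S` are (matrices of) Eichler
transvections orthogonal to `S`. [folklore] -/
theorem exp_smul_toMatrix_eichlerT_mem (hB : B.IsSymm) {u w : n → ℝ} {S : Set (n → ℝ)}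
    (huu : B u u = 0) (huw : B u w = 0) (huS : ∀ z ∈ S, B u z = 0) (hwS : ∀ z ∈ S, B w z = 0)
    (t : ℝ) :
    IsNilpotent.exp (t • LinearMap.toMatrix'
        (LinearMap.smulRight (B u) w - LinearMap.smulRight (B w) u : Module.End ℝ (n → ℝ))) ∈
      LinearMap.toMatrix' '' eichlerGens B S := by
  rw [exp_smul_toMatrix_eichlerT hB huu huw t]
  refine ⟨_, ⟨u, t • w, huu, by rw [map_smul, smul_eq_mul, huw, mul_zero], huS, fun z hz => ?_, rfl⟩,
    rfl⟩
  rw [map_smul, LinearMap.smul_apply, smul_eq_mul, hwS z hz, mul_zero]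

/-- Conversely every Eichler transvection orthogonal to `S` is the time-one value of an Eichler
flow orthogonal to `S`. [folklore] -/
theorem exists_exp_eq_of_mem_eichlerGens (hB : B.IsSymm) {S : Set (n → ℝ)}
    {E : Module.End ℝ (n → ℝ)} (hE : E ∈ eichlerGens B S) :
    ∃ u w : n → ℝ, B u u = 0 ∧ B u w = 0 ∧ (∀ z ∈ S, B u z = 0) ∧ (∀ z ∈ S, B w z = 0) ∧
      LinearMap.toMatrix' E = IsNilpotent.exp ((1 : ℝ) • LinearMap.toMatrix'
        (LinearMap.smulRight (B u) w - LinearMap.smulRight (B w) u : Module.End ℝ (n → ℝ))) := by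
  obtain ⟨u, w, huu, huw, huS, hwS, rfl⟩ := hE
  refine ⟨u, w, huu, huw, huS, hwS, ?_⟩
  rw [exp_smul_toMatrix_eichlerT hB huu huw 1, one_smul]

end ExpBridge

end Literature.Dynamics.Homogeneous
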